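import Literature.AlgebraicGeometry.Frobenioids.NonPreservationOfUnits
import Literature.AlgebraicGeometry.Frobenioids.ElementaryFrobeniusCompact
import Literature.AlgebraicGeometry.Frobenioids.IrreducibleMorphismsCounterexample
import Literature.AlgebraicGeometry.Frobenioids.ArithmeticFrobenioidIsotropic
import Literature.AlgebraicGeometry.Frobenioids.MonoidTransport
import Mathlib.Algebra.Group.Equiv.TypeTags
import HarnessLib

/-!
# Frobenioids I, Example 3.9 (non-preservation of units): the Frobenioid-level claims PROVED

Mochizuki, *The geometry of Frobenioids I: the general theory*, Kyushu J. Math. **62** (2008)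
293–400, kurims text pp. 71–72 [cite: MochizukiFrdI2008, Ex. 3.9 pp.71-72]. PROOF-ONLY companion of
`NonPreservationOfUnits.lean` (seat abc-iut-L1-t8; `G = ℚ ⋊ N`, `D = B(G)`, `Φ = V × W = ℚ × ℤ_{≥0}` with
`g ↦ (n, 1)`, `C := F_Φ`), whose module docstring deferred the claims below until [FrdI] Def. 1.2/1.3/3.1
landed. "`C`" is the elementary Frobenioid `F_Φ → F_{Φ^char}` (found's `ElemFrobenioid.toChar`).

PROVED (p. 72): `Φ` is a monoid on `D` (bijective pull-backs) with pre-divisorial value `ℚ × ℤ_{≥0}`;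
"`C` is a Frobenioid of Frobenius-normalized and isotropic type, which is not of group-like type
[cf. Proposition 1.5, (i), (ii)]" (`Ex39.isFrobenioid`, `…isOfType_isFrobeniusNormalized`, `…isOfIsotropicType`,
`…not_isOfType_isGroupLikeObj`); "Thus, `C` is of standard type" (`Ex39.isOfStandardType`; (b) is vacuous — not
group-like; (d) = `Ex39.isOfFSMFFType_D`; (e) `Φ^char ≅ ℤ_{≥0}` carries the trivial action: "[manifestly
non-dilating]", `Ex39.isNonDilatingOn_char`). Already landed: "`D` fails to be Frobenius-slim"
(`RatSemidirect.not_isFrobeniusSlim_D`) and Rem. 4.11.2 "`D` fails to be Div-slim" (`Ex39.not_isDivSlim`), both in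
`DivSlimExampleProofs.lean`; the automorphism of the printed monoid `M` (`NonPreservationOfUnits.lean`).
No statement of the paper is strengthened; nothing here takes a side on [IUTchIII] Cor. 3.12.
-/

namespace Literature.AlgebraicGeometry.Frobenioids

open CategoryTheory Opposite

namespace Ex39

open RatSemidirect

/-- The actions `act g` are bijective (inverse `act g⁻¹`). [cite: MochizukiFrdI2008, Ex. 3.9 p.72] -/
theorem act_bijective (g : G) : Function.Bijective (Literature.AlgebraicGeometry.Frobenioids.Ex39.act g) := by
  refine Function.bijective_iff_has_inverse.mpr ⟨act g⁻¹, fun x => ?_, fun x => ?_⟩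
  · show ((act g⁻¹).comp (act g)) x = x
    rw [← act_mul, mul_inv_cancel, act_one, MonoidHom.id_apply]
  · show ((act g).comp (act g⁻¹)) x = x
    rw [← act_mul, inv_mul_cancel, act_one, MonoidHom.id_apply]

/-- **Example 3.9**: `Φ` "[manifestly non-dilating] monoid on `D`" — `Φ` is a monoid on `D` in the sense of
Def. 1.1 (ii) (all pull-backs are bijective). [cite: MochizukiFrdI2008, Ex. 3.9 p.72] -/
theorem isMonoidOn_Φ : IsMonoidOn Literature.AlgebraicGeometry.Frobenioids.Ex39.Φ :=
  isMonoidOn_of_bijective fun f => act_bijective (show G from f)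

/-- `V × W = ℚ × ℤ_{≥0}` is pre-divisorial (a product of the group `ℚ` and the pre-divisorial `ℤ_{≥0}`).
[cite: MochizukiFrdI2008, Ex. 3.9 p.72] -/
theorem isPreDivisorial_VW : IsPreDivisorial (Multiplicative (ℚ × ℕ)) :=
  IsPreDivisorial.of_mulEquiv (MulEquiv.prodMultiplicative (G := ℚ) (H := ℕ)).symm
    ((isGroupLike_of_commGroup (Multiplicative ℚ)).isPreDivisorial.prod StandardFrobenioidExample.isPreDivisorial_M)

/-- `Φ` is (objectwise) pre-divisorial. [cite: MochizukiFrdI2008, Ex. 3.9 p.72] -/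
theorem objectwise_isPreDivisorial_Φ :
    Objectwise (fun N _ => IsPreDivisorial N) Literature.AlgebraicGeometry.Frobenioids.Ex39.Φ :=
  fun _ => isPreDivisorial_VW

/-- **Example 3.9**: "`C := F_Φ`. Thus, `C` is a Frobenioid" — `F_Φ → F_{Φ^char}` is a Frobenioid (Prop. 1.5 (i),
over the connected, totally epimorphic `D = B(G)`). [cite: MochizukiFrdI2008, Ex. 3.9 p.72] -/
theorem isFrobenioid :
    PreFrobenioid.IsFrobenioid (ElemFrobenioid.toChar Literature.AlgebraicGeometry.Frobenioids.Ex39.Φ) :=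
  ElemFrobenioid.isFrobenioid_toChar isMonoidOn_Φ objectwise_isPreDivisorial_Φ (isGraphConnected_singleObj G)
    ⟨fun _ => inferInstance⟩

/-- **Example 3.9**: "… of Frobenius-normalized … type" (Prop. 1.5 (i)). [cite: MochizukiFrdI2008, Ex. 3.9 p.72] -/
theorem isOfType_isFrobeniusNormalized :
    PreFrobenioid.IsOfType (PreFrobenioid.IsFrobeniusNormalized
      (ElemFrobenioid.toChar Literature.AlgebraicGeometry.Frobenioids.Ex39.Φ)) :=
  fun A => ElemFrobenioid.isFrobeniusNormalized A

/-- **Example 3.9**: "… and isotropic type" (Prop. 1.5 (i)). [cite: MochizukiFrdI2008, Ex. 3.9 p.72] -/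
theorem isOfIsotropicType :
    PreFrobenioid.IsOfIsotropicType (ElemFrobenioid.toChar Literature.AlgebraicGeometry.Frobenioids.Ex39.Φ) :=
  fun A => ElemFrobenioid.isIsotropic A

/-- A unit of `ℚ × ℤ_{≥0}` has trivial `ℤ_{≥0}`-component. [cite: MochizukiFrdI2008, Ex. 3.9 p.72] -/
theorem toAdd_snd_eq_zero_of_isUnit {x : Multiplicative (ℚ × ℕ)} (hx : IsUnit x) : (Multiplicative.toAdd x).2 = 0 := by
  obtain ⟨u, rfl⟩ := hx
  have h := congrArg (fun y : Multiplicative (ℚ × ℕ) => (Multiplicative.toAdd y).2) u.mul_inv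
  simp only [toAdd_mul, Prod.snd_add, toAdd_one, Prod.snd_zero] at h
  omega

/-- **Example 3.9**: "… which is not of group-like type [cf. Proposition 1.5, (i), (ii)]" — the class of
`(0, 1) ∈ V × W` in `Φ^char` is not trivial. [cite: MochizukiFrdI2008, Ex. 3.9 p.72] -/
theorem not_isOfType_isGroupLikeObj :
    ¬ PreFrobenioid.IsOfType (PreFrobenioid.IsGroupLikeObj
      (ElemFrobenioid.toChar Literature.AlgebraicGeometry.Frobenioids.Ex39.Φ)) := by
  intro h
  have h1 : Associates.mk (Multiplicative.ofAdd (((0 : ℚ), (1 : ℕ))) : Multiplicative (ℚ × ℕ)) = 1 := h obj _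
  rw [Associates.mk_eq_one] at h1
  have h2 := toAdd_snd_eq_zero_of_isUnit h1
  simp at h2

/-! ### Clause (e): `Φ^char ≅ ℤ_{≥0}` carries the trivial action -/

/-- `g^*(x, y) = (n · x, y)` is associated to `(x, y)` in `ℚ × ℤ_{≥0}` (they differ by the unit `((n − 1) x, 0)`):
`G` acts trivially on `Φ^char`. [cite: MochizukiFrdI2008, Ex. 3.9 p.72] -/
theorem associated_act (g : G) (z : Multiplicative (ℚ × ℕ)) : Associated (act g z) z := by
  let x : ℚ := (Multiplicative.toAdd z).1
  refine ⟨⟨Multiplicative.ofAdd (((1 - (g.n : ℚ)) * x, (0 : ℕ))), Multiplicative.ofAdd ((((g.n : ℚ) - 1) * x, (0 : ℕ))),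
    ?_, ?_⟩, ?_⟩
  · apply Multiplicative.toAdd.injective
    rw [toAdd_mul, toAdd_ofAdd, toAdd_ofAdd, Prod.mk_add_mk, toAdd_one]
    refine Prod.ext ?_ ?_
    · show (1 - (g.n : ℚ)) * x + ((g.n : ℚ) - 1) * x = 0
      ring
    · rfl
  · apply Multiplicative.toAdd.injective
    rw [toAdd_mul, toAdd_ofAdd, toAdd_ofAdd, Prod.mk_add_mk, toAdd_one]
    refine Prod.ext ?_ ?_
    · show ((g.n : ℚ) - 1) * x + (1 - (g.n : ℚ)) * x = 0
      ring
    · rfl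
  · apply Multiplicative.toAdd.injective
    rw [toAdd_mul, toAdd_act]
    show ((g.n : ℚ) * (Multiplicative.toAdd z).1, (Multiplicative.toAdd z).2) + ((1 - (g.n : ℚ)) * x, 0) = Multiplicative.toAdd z
    refine Prod.ext ?_ ?_
    · show (g.n : ℚ) * (Multiplicative.toAdd z).1 + (1 - (g.n : ℚ)) * x = (Multiplicative.toAdd z).1
      ring
    · show (Multiplicative.toAdd z).2 + 0 = (Multiplicative.toAdd z).2
      rw [add_zero]

/-- Hence every `g ∈ G` induces the identity of `Φ^char = (ℚ × ℤ_{≥0}) / (ℚ × 0) ≅ ℤ_{≥0}`.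
[cite: MochizukiFrdI2008, Ex. 3.9 p.72] -/
theorem associatesMap_act (g : G) (b : Associates (Multiplicative (ℚ × ℕ))) : associatesMap (act g) b = b := by
  obtain ⟨z, rfl⟩ := Associates.mk_surjective b
  rw [associatesMap_mk, Associates.mk_eq_mk_iff_associated]
  exact associated_act g z

/-- **Example 3.9**: `Φ` is "[manifestly non-dilating]" — in the form needed for Def. 3.1 (i)(e): the divisor monoid
`Φ^char` of `F_Φ → F_{Φ^char}` is non-dilating (every endomorphism of `D` induces the identity on `Φ^char`).
[cite: MochizukiFrdI2008, Ex. 3.9 p.72] -/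
theorem isNonDilatingOn_char :
    (PreFrobenioidData.ofFunctor (charFunctor Literature.AlgebraicGeometry.Frobenioids.Ex39.Φ)
      (ElemFrobenioid.toChar Literature.AlgebraicGeometry.Frobenioids.Ex39.Φ)).IsNonDilatingOn := by
  refine ⟨fun X f _ a => ?_⟩
  obtain ⟨b, rfl⟩ := Associates.mk_surjective a
  rw [associatesMap_mk]
  exact congrArg Associates.mk (associatesMap_act (show G from f) b)

/-- **Example 3.9**: "Thus, `C` is of standard type" (FrdI p. 72; Def. 3.1 (i): (a), (c) by Prop. 1.5 (i); (b) vacuous,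
`C` not being of group-like type; (d) "`D` is manifestly of FSM-, hence also of FSMFF-type" (`isOfFSMFFType_D`); (e)
`isNonDilatingOn_char`) — PROVED for `F_Φ → F_{Φ^char}`. [cite: MochizukiFrdI2008, Ex. 3.9 p.72] -/
theorem isOfStandardType :
    (PreFrobenioidData.ofFunctor (charFunctor Literature.AlgebraicGeometry.Frobenioids.Ex39.Φ)
      (ElemFrobenioid.toChar Literature.AlgebraicGeometry.Frobenioids.Ex39.Φ)).IsOfStandardType :=
  ElemFrobenioid.isOfStandardType_toChar_of isMonoidOn_Φ objectwise_isPreDivisorial_Φ (isGraphConnected_singleObj G)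
    ⟨fun _ => inferInstance⟩ (fun h => (not_isOfType_isGroupLikeObj h).elim) isOfFSMFFType_D isNonDilatingOn_char

end Ex39

end Literature.AlgebraicGeometry.Frobenioids
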